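import Literature.AnabelianGeometry.EtaleTheta.ConstantsDictionary
import Literature.AnabelianGeometry.EtaleTheta.Discharge.Sec5HgcOfConstantsDictionary
import Literature.AnabelianGeometry.EtaleTheta.Discharge.Sec5Lem59ivOfSettingDictionary

/-!
# [EtTh] §5: every arithmetic binder of Lemma 5.8 / Lemma 5.9 (iv) / Theorem 5.10 (iii) from ONE binder — the constants of `B_N` read in `ℚ̄_p` (pp. 331–335 / PDF pp. 105–109)

Mochizuki, *The étale theta function and its Frobenioid-theoretic manifestations*, Publ. RIMS **45** (2009)
[cite: MochizukiEtTh2009, Lem 5.8 p.331 (PDF p.105)]; Lemma 5.9 (iv) p.332 (PDF p.106); Thm. 5.10 (iii) p.334 (PDF p.108); Def. 3.6 (iv)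
p.304 (PDF p.78).  Layer L2 of the abc-iut cell, seat abc-iut-L2-t11 (gen 4); abc-iut-L2-lead (gen 4) ruling R229 «CONSTANTS-DICTIONARY
BUNDLE», FILE 2 = the PROOF-ONLY KNIT over the predicate `ThetaFrobenioid.BiratAutAction.ConstantsDictionary`
(`ConstantsDictionary.lean`, FILE 1): from the ONE binder `hD : ConstantsDictionary α Cu μ hC hS ι m Cst ν̃` every consumer's arithmetic
input follows —
* `ConstantsDictionary.hgc` — abc-iut-L2-t4's `hgc` (GAP G-L2t4-4; `facts_ofConnectedTemperoidData` / `facts_ofThetaSettingData`), via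
  this seat's `hgc_of_constantsDictionary` (p438336): "a unit of `B_N` commuting with `s^⊓-gp_N(Im Π^tp_Y̲)` is a constant of `K`";
* `ConstantsDictionary.hsurj` — abc-iut-L2-t4's `hsurj` (first clause of `KxRootNModCyclotome`, Lemma 5.8 "`(K^×)^{1/N}/μ_N(B_N) ⥲ K^×`"),
  via `hsurj_of_constantsDictionary` (p438929); hence at the junction `KxRootNModCyclotome` by abc-iut-L2-t4's
  `kxRootNModCyclotome_ofThetaSettingData_of_surj`;
* the ν-package `nu_muToBirat` / `nu_kummer` / `nu_roots` (the laws `hνμ`, `hνeq`, `hνN` of this seat's Galois dictionary for the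
  restricted reading `ν := ν̃|_{(K^×)^{1/N}}`), whence `ConstantsDictionary.hgeom` (GAP G-L2t11-1, p424113 `hgeom_of_galoisDictionary`),
  `ConstantsDictionary.cyclotomicCharacterCompatX` (F-1306, p424113; its junction form is abc-iut-f-125's p437488, `tf`-intrinsic form
  p438316), and **`ConstantsDictionary.envIsoBiTheta_kummerOut` / `frdIsMonoThetaEnv_kummerOut` / `monoThetaEnvCompat_kummerOut`** —
  [EtTh] Lemma 5.9 (iv) (abc-iut-L2-t4's `EnvIsoBiTheta`), its "In particular" (`FrdIsMonoThetaEnv` = the [IUTchII] Prop. 1.2 (ii) binder `hM`)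
  and Theorem 5.10 (iii) (`MonoThetaEnvCompat`) at the honest `K^×`-part `DK := kummerOut` against abc-iut-L2-t8's model of the setting
  (this seat's p437577), with the dictionary binders DISCHARGED from `hD`.
RESIDUAL after the ONE binder (all named in the signatures): the §5 named inputs / `Facts`, `KxRootNModCyclotome` (second clause —
abc-iut-L2-t4 at the junction from perfection), `IdentifiesPiY/PiYdd` (rfl at `ι := id`), the Prop. 5.2 (iii) dictionary `hcompat`
(F-0521 ⟺ `θ := Θ̈`, GAP G-L2t4-2), «`Π^tp_X → G_K` open» (`hopenX`, ⟸ temperedness, abc-iut-w5-d233 p437556), and for Thm. 5.10 (iii)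
the clause `hΔ` (⟸ Cor. 2.18 (i)).
HONEST FRAMING: kernel-checked compositions; the dictionary is a hypothesis (not constructed for an actual curve); nothing of [EtTh] is
asserted unconditionally; typed ≠ proved; no side is taken on anything downstream ([IUTchIII] Cor. 3.12).
-/

noncomputable section

namespace Literature.AnabelianGeometry.EtaleTheta

open CategoryTheory Literature.AnabelianGeometry.SemiGraphs
open scoped Pointwise

universe w u u' v'

namespace ThetaFrobenioid

variable {C₀ : Type u} [Category.{0} C₀] {D₀ : Type u'} [Category.{v'} D₀] {𝔉 : ThetaFrobenioid.{w} C₀ D₀}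

namespace BiratAutAction

namespace ConstantsDictionary

variable {α : 𝔉.BiratAutAction} {p : ℕ} [Fact p.Prime] {D : ThetaSetting p} {E : D.EtaleThetaData} {l : ℕ}
  {Cu : E.DoubleUnderline l} {μ : D.CyclotomeMod l 𝔉.N} {hC : D.Compat} {hS : D.Sec2Hyps}
  {ι : 𝔉.PiX ≃ₜ* (Cu.thetaEnvData μ hC hS).PiX} {m : 𝔉.muTorsion 𝔉.BN 𝔉.N ≃* (Cu.thetaEnvData μ hC hS).mu}
  {Cst : Subgroup (𝔉.biratUnits 𝔉.BN)} {ν' : Cst →* (PadicAlgCl p)ˣ}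
  (hD : ConstantsDictionary α Cu μ hC hS ι m Cst ν')
include hD

/-! ### The ν-package: the Galois-dictionary laws for the restricted reading `ν := ν̃|_{(K^×)^{1/N}}` -/

/-- The law `hνμ` of the Galois dictionary for the restricted reading `ν := ν̃ ∘ ((K^×)^{1/N} ↪ Cst)`: `ν` agrees with `m` on
`μ_N(B_N) ⊆ (K^×)^{1/N}`.  [cite: MochizukiEtTh2009, Lem 5.8 p.331 (PDF p.105)] -/
theorem nu_muToBirat (u : 𝔉.muTorsion 𝔉.BN 𝔉.N) (hu : 𝔉.muToBirat u ∈ 𝔉.KxRootN) :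
    ν'.comp (Subgroup.inclusion hD.kxRootN_le) ⟨𝔉.muToBirat u, hu⟩ = ((m u : MuN p 𝔉.N) : (PadicAlgCl p)ˣ) :=
  hD.mu_compat u

/-- The law `hνeq` of the Galois dictionary (in the `G_K ≤ Gal(ℚ̄_p/ℚ_p)` form) for the restricted reading: the Kummer cocycle
`κ_f(s^⊓-gp_N(ρ y)) = (e·f)·f⁻¹` of an `N`-th root of a constant `f`, read in `ℚ̄_p` through `m`, satisfies
`m(κ) · ν(f) = aug(ι y) · ν(f)` — "acts via multiplication by an element of `μ_N(B_N)`" (Lemma 5.8 proof).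
[cite: MochizukiEtTh2009, Lem 5.8 proof p.331 (PDF p.105)] -/
theorem nu_kummer (hK : 𝔉.KxRootNModCyclotome) (f : 𝔉.KxRootN) (y : 𝔉.PiX) :
    (((m (α.kummerCocycle hK f (𝔉.sgpCap (𝔉.ρ y))) : MuN p 𝔉.N) : (PadicAlgCl p)ˣ)) *
        ν'.comp (Subgroup.inclusion hD.kxRootN_le) f =
      (((Cu.thetaEnvData μ hC hS).aug (ι y) : D.GK) : GQp p) • ν'.comp (Subgroup.inclusion hD.kxRootN_le) f := by
  have hκ := α.muToBirat_kummerCocycle hK f (𝔉.sgpCap (𝔉.ρ y))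
  -- `κ · f = e·f` inside `Cst`, then read in `ℚ̄_p`
  have hmem : 𝔉.muToBirat (α.kummerCocycle hK f (𝔉.sgpCap (𝔉.ρ y))) ∈ Cst :=
    hD.units_mem ⟨(α.kummerCocycle hK f (𝔉.sgpCap (𝔉.ρ y)) : Aut 𝔉.BN), 𝔉.muTorsion_le_units _ _
      (α.kummerCocycle hK f (𝔉.sgpCap (𝔉.ρ y))).2⟩
  have hprod : (⟨𝔉.muToBirat (α.kummerCocycle hK f (𝔉.sgpCap (𝔉.ρ y))), hmem⟩ : Cst) *
      ⟨(f : 𝔉.biratUnits 𝔉.BN), hD.kxRootN_le f.2⟩ =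
        ⟨α.act (𝔉.sgpCap (𝔉.ρ y)) (f : 𝔉.biratUnits 𝔉.BN), hD.act_mem _ _ (hD.kxRootN_le f.2)⟩ := by
    apply Subtype.ext
    change 𝔉.muToBirat (α.kummerCocycle hK f (𝔉.sgpCap (𝔉.ρ y))) * (f : 𝔉.biratUnits 𝔉.BN) = _
    rw [hκ, inv_mul_cancel_right]
  have h := congrArg ν' hprod
  rw [map_mul, hD.equivariant y ⟨(f : 𝔉.biratUnits 𝔉.BN), hD.kxRootN_le f.2⟩] at h
  rw [MonoidHom.comp_apply, ← hD.mu_compat]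
  exact h

/-- The law `hνN` of the Galois dictionary for the restricted reading: every element of `K^×` has an `N`-th root among the read
constants.  [cite: MochizukiEtTh2009, Lem 5.8 p.331 (PDF p.105)] -/
theorem nu_roots (y : (D.K)ˣ) :
    ∃ f : 𝔉.KxRootN, ((ν'.comp (Subgroup.inclusion hD.kxRootN_le) f : (PadicAlgCl p)ˣ) : PadicAlgCl p) ^ (𝔉.N : ℕ) =
      algebraMap D.K (PadicAlgCl p) (y : D.K) :=
  hD.roots_of_K y


/-! ### Lemma 5.8's two arithmetic steps from the ONE binder -/

/-- **GAP G-L2t4-4 `hgc` from the ONE binder**: abc-iut-L2-t4's hypothesis of `facts_ofConnectedTemperoidData` / `facts_ofThetaSettingData`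
("a unit of `B_N` commuting with `s^⊓-gp_N(Im Π^tp_Y̲)` is a constant of `K`", Lemma 5.8, "geometrically connected over `K`"), via
`hgc_of_constantsDictionary` (p438336; Galois descent `ℚ̄_p^{G_K} = K`).  [cite: MochizukiEtTh2009, Lem 5.8 p.331 (PDF p.105)] -/
theorem hgc (hY : 𝔉.IdentifiesPiY (Cu.thetaEnvData μ hC hS) ι.toMulEquiv) :
    ∀ u : 𝔉.units 𝔉.BN, (∀ y ∈ 𝔉.imPiY, 𝔉.sgpCap y * (u : Aut 𝔉.BN) * (𝔉.sgpCap y)⁻¹ = u) →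
      𝔉.unitsToBirat 𝔉.BN u ∈ 𝔉.constEmb.range :=
  α.hgc_of_constantsDictionary Cu μ hC hS ι hY Cst hD.units_mem hD.constEmb_mem (fun _ x hx => hD.act_mem _ x hx) ν'
    hD.injective hD.equivariant hD.reaches_K

/-- **Lemma 5.8 "`(K^×)^{1/N} → K^×` onto" (abc-iut-L2-t4's `hsurj`) from the ONE binder**, via `hsurj_of_constantsDictionary` (p438929);
at the junction abc-iut-L2-t4's `kxRootNModCyclotome_ofThetaSettingData_of_surj` turns it into `KxRootNModCyclotome`.
[cite: MochizukiEtTh2009, Lem 5.8 p.331 (PDF p.105)] -/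
theorem hsurj : ∀ k : 𝔉.Kˣ, ∃ f ∈ 𝔉.KxRootN, f ^ (𝔉.N : ℕ) = 𝔉.constEmb k :=
  hsurj_of_constantsDictionary Cst hD.constEmb_mem hD.kxRootN_le ν' hD.injective hD.constEmb_read hD.roots_of_K

/-- **GAP G-L2t11-1 `hgeom` from the ONE binder**: an element of `Π^tp_Y̲` over `1 ∈ G_K` fixes the `N`-th roots of constants
(this seat's gen-3 `hgeom_of_galoisDictionary`, p424113, with the `T`-side of the dictionary discharged at the setting).
[cite: MochizukiEtTh2009, Lem 5.8 proof p.331 (PDF p.105)] -/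
theorem hgeom (hK : 𝔉.KxRootNModCyclotome) (f : 𝔉.KxRootN) (y : 𝔉.PiX) (hy : y ∈ 𝔉.PiY)
    (haug : (Cu.thetaEnvData μ hC hS).aug (ι y) = 1) :
    α.act (𝔉.sgpCap (𝔉.ρ y)) (f : 𝔉.biratUnits 𝔉.BN) = f :=
  α.hgeom_of_galoisDictionary hK (Cu.thetaEnvData μ hC hS) ι m
    (Literature.FieldTheory.Galois.fixingSubgroupMulEquiv D.K (AlgEquiv.refl : PadicAlgCl p ≃ₐ[D.K] PadicAlgCl p))
    (rootsOfUnity 𝔉.N (PadicAlgCl p)).subtype (ν'.comp (Subgroup.inclusion hD.kxRootN_le))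
    (rootsOfUnity 𝔉.N (PadicAlgCl p)).subtype_injective
    (α.hνeq_of_smul hK Cu μ hC hS ι m (ν'.comp (Subgroup.inclusion hD.kxRootN_le)) (hD.nu_kummer hK)) f y hy haug

/-- **F-1306 `CyclotomicCharacterCompatX` from the ONE binder** (generic form of this seat's p424113; at the junction
`ofThetaSettingData` this is abc-iut-f-125's `cyclotomicCharacterCompatX_ofThetaSettingData_of_constantsDictionary`, p437488): conjugation
by `s^⊓-gp_N(ρ g)` on `μ_N(B_N)` is the cyclotomic character `χ(aug(ι g))` under `m`.
[cite: MochizukiEtTh2009, Lem 5.8 proof p.331 (PDF p.105)] -/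
theorem cyclotomicCharacterCompatX (hK : 𝔉.KxRootNModCyclotome) :
    𝔉.CyclotomicCharacterCompatX (Cu.thetaEnvData μ hC hS) ι.toMulEquiv m :=
  α.cyclotomicCharacterCompatX_of_galoisDictionary hK (Cu.thetaEnvData μ hC hS) ι m
    (Literature.FieldTheory.Galois.fixingSubgroupMulEquiv D.K (AlgEquiv.refl : PadicAlgCl p ≃ₐ[D.K] PadicAlgCl p))
    (rootsOfUnity 𝔉.N (PadicAlgCl p)).subtype (ν'.comp (Subgroup.inclusion hD.kxRootN_le))
    (rootsOfUnity 𝔉.N (PadicAlgCl p)).subtype_injective (Cu.thetaEnvData_chi_dictionary μ hC hS)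
    (fun u => (hD.mu_compat u).trans (Subgroup.subtype_apply _).symm)
    (α.hνeq_of_smul hK Cu μ hC hS ι m (ν'.comp (Subgroup.inclusion hD.kxRootN_le)) (hD.nu_kummer hK))

/-! ### Lemma 5.9 (iv) and Theorem 5.10 (iii) at `DK := kummerOut` from the ONE binder -/

/-- **[EtTh] Lemma 5.9 (iv) at `DK := kummerOut` against the model of the setting, from the ONE binder** (this seat's
`envIsoBiTheta_kummerOut_ofSetting`, p437577, with `ν`, `hνμ`, `hνeq`, `hνN` supplied by `hD`).  Residual: `Facts`, `KxRootNModCyclotome`,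
`IdentifiesPiY/PiYdd`, «`Π^tp_X → G_K` open», the Prop. 5.2 (iii) dictionary `hcompat`.
[cite: MochizukiEtTh2009, Lem 5.9 (iv) p.332 (PDF p.106)] -/
theorem envIsoBiTheta_kummerOut (hK : 𝔉.KxRootNModCyclotome) (h1 : 𝔉.SectionsFactor) (h3 : 𝔉.OuterActionLZ)
    (hsec : 𝔉.SgpCapSection) (hcs : 𝔉.SgpCupSection) (h8 : 𝔉.ConstantsEqNormalizer) (H : 𝔉.Facts)
    (hY : 𝔉.IdentifiesPiY (Cu.thetaEnvData μ hC hS) ι.toMulEquiv)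
    (hYdd : 𝔉.IdentifiesPiYdd (Cu.thetaEnvData μ hC hS) ι.toMulEquiv)
    (hopenX : IsOpenMap fun x : D.PiTemp => (⟨D.aug x, D.aug_mem_GK x⟩ : D.GK))
    {η : (Cu.thetaEnvData μ hC hS).PiYdd → (Cu.thetaEnvData μ hC hS).mu}
    (hη : η ∈ (Cu.thetaEnvData μ hC hS).thetaCocycles)
    (hcompat : 𝔉.ThetaSectionCompat H (Cu.thetaEnvData μ hC hS) ι.toMulEquiv m hYdd η) :
    𝔉.EnvIsoBiTheta h1 h3 hsec hcs h8 (α.kummerOut hK) (Cu.thetaEnvData μ hC hS) ι :=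
  α.envIsoBiTheta_kummerOut_ofSetting hK h1 h3 hsec hcs h8 Cu μ hC hS ι m (ν'.comp (Subgroup.inclusion hD.kxRootN_le)) H hY hYdd
    hopenX hD.mu_compat (hD.nu_kummer hK) hD.roots_of_K hη hcompat

/-- **Lemma 5.9 (iv) "In particular" — the [IUTchII] Prop. 1.2 (ii) binder `hM` — at `DK := kummerOut`, from the ONE binder.**
[cite: MochizukiEtTh2009, Lem 5.9 (iv) p.332 (PDF p.106)] -/
theorem frdIsMonoThetaEnv_kummerOut (hK : 𝔉.KxRootNModCyclotome) (h1 : 𝔉.SectionsFactor) (h3 : 𝔉.OuterActionLZ)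
    (hsec : 𝔉.SgpCapSection) (hcs : 𝔉.SgpCupSection) (h8 : 𝔉.ConstantsEqNormalizer) (H : 𝔉.Facts)
    (hY : 𝔉.IdentifiesPiY (Cu.thetaEnvData μ hC hS) ι.toMulEquiv)
    (hYdd : 𝔉.IdentifiesPiYdd (Cu.thetaEnvData μ hC hS) ι.toMulEquiv)
    (hopenX : IsOpenMap fun x : D.PiTemp => (⟨D.aug x, D.aug_mem_GK x⟩ : D.GK))
    {η : (Cu.thetaEnvData μ hC hS).PiYdd → (Cu.thetaEnvData μ hC hS).mu}
    (hη : η ∈ (Cu.thetaEnvData μ hC hS).thetaCocycles)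
    (hcompat : 𝔉.ThetaSectionCompat H (Cu.thetaEnvData μ hC hS) ι.toMulEquiv m hYdd η) :
    𝔉.FrdIsMonoThetaEnv h1 h3 hsec hcs h8 (α.kummerOut hK) (Cu.thetaEnvData μ hC hS) :=
  α.frdIsMonoThetaEnv_kummerOut_ofSetting hK h1 h3 hsec hcs h8 Cu μ hC hS ι m (ν'.comp (Subgroup.inclusion hD.kxRootN_le)) H hY
    hYdd hopenX hD.mu_compat (hD.nu_kummer hK) hD.roots_of_K hη hcompat

/-- **[EtTh] Theorem 5.10 (iii) (abc-iut-L2-t4's `MonoThetaEnvCompat`) at `DK := kummerOut` against the model of the setting, from the ONE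
binder** (this seat's `monoThetaEnvCompat_kummerOut_ofSetting`, p437577).  Residual: `KxRootNModCyclotome`, `Facts`, `IdentifiesPiY`,
«`Π^tp_X → G_K` open», the clause `hΔ` (⟸ Cor. 2.18 (i)), Theorem 5.10 (ii) as typed (`PsiAutPreserves`) with the representative `ψY`.
[cite: MochizukiEtTh2009, Thm 5.10 (iii) p.334–335 (PDF pp.108–109)] -/
theorem monoThetaEnvCompat_kummerOut (hK : 𝔉.KxRootNModCyclotome) (h1 : 𝔉.SectionsFactor) (h3 : 𝔉.OuterActionLZ)
    (hsec : 𝔉.SgpCapSection) (hcs : 𝔉.SgpCupSection) (h8 : 𝔉.ConstantsEqNormalizer) (H : 𝔉.Facts)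
    (hY : 𝔉.IdentifiesPiY (Cu.thetaEnvData μ hC hS) ι.toMulEquiv)
    (hopenX : IsOpenMap fun x : D.PiTemp => (⟨D.aug x, D.aug_mem_GK x⟩ : D.GK))
    (hΔ : ∀ (ψ : 𝔉.PiX ≃ₜ* 𝔉.PiX), ∀ y ∈ 𝔉.PiY,
      (Cu.thetaEnvData μ hC hS).aug (ι (ψ y)) = 1 ↔ (Cu.thetaEnvData μ hC hS).aug (ι y) = 1)
    (Ψ : C₀ ≌ C₀) (β : Ψ.functor.obj 𝔉.BN ≅ 𝔉.BN) (ΨbiratAut : 𝔉.biratUnits 𝔉.BN ≃* 𝔉.biratUnits 𝔉.BN)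
    (hii : 𝔉.PsiAutPreserves Ψ β ΨbiratAut) (ψY : 𝔉.PiX ≃ₜ* 𝔉.PiX)
    (hbase : ∀ g, 𝔉.autBase 𝔉.BN (𝔉.psiAut Ψ β (𝔉.sgpCap (𝔉.ρ g))) = 𝔉.ρ (ψY g))
    (hψY : 𝔉.PiY.map ψY.toMulEquiv.toMonoidHom = 𝔉.PiY)
    (hψYdd : 𝔉.PiYdd.map ψY.toMulEquiv.toMonoidHom = 𝔉.PiYdd) :
    𝔉.MonoThetaEnvCompat h1 h3 hsec hcs h8 (α.kummerOut hK) Ψ β ψY hbase hψY hψYdd :=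
  α.monoThetaEnvCompat_kummerOut_ofSetting hK h1 h3 hsec hcs h8 Cu μ hC hS ι m (ν'.comp (Subgroup.inclusion hD.kxRootN_le)) H hY
    hopenX hD.mu_compat (hD.nu_kummer hK) hD.roots_of_K hΔ Ψ β ΨbiratAut hii ψY hbase hψY hψYdd

end ConstantsDictionary

end BiratAutAction

end ThetaFrobenioid

end Literature.AnabelianGeometry.EtaleTheta

end
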